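import Mathlib
import Literature.AlgebraicGeometry.Tropical.TorusCycles
import Summits.HodgeConjecture.HodgeConjecture.Theorems.TropicalWeilObstructionTropicalWeilVanishingTransportFrames
import HarnessLib

/-!
# The phase law for complete-intersection cells at the split point (K1-SCOPE §8)

Helper for crux K1 (`TropicalWeilVanishing`, stmt-HodgeConjecture-18478) of route
`TropicalWeilObstruction` — negation-sink work of cell `pub-hodge-tropical` (tropical-1 gen 11); it
decides nothing about K1 and nothing here bears on the Hodge conjecture.

At the split period `Q₀ = A ⊕ A` (`B = 0`) the tropical Weil `2n`-fold is `X_A × X_A`, and for a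
homomorphism `h_k = (p_k, q_k) : (x, y) ↦ p_k x + q_k y` the pulled-back theta divisor `h_k^* Θ_A` has,
near a generic point, the local equation `m_k · (p_k x + q_k y) = const` for a facet normal `m_k` of
`Θ_A`. A transversal cell of the complete intersection `h_1^*Θ_A ⋯ h_n^*Θ_A` therefore lies in the
`n`-plane `{(u, v) : m_k · (p_k u + q_k v) = 0, k < n}` with `M = (m_k)` invertible: every column
`(u | v)` of a lattice frame `L` of the cell satisfies `(M u)_k = q_k t_k`, `(M v)_k = -p_k t_k` for real
`t_k`. The theorem below is the resulting PHASE LAW: `η(L) = frameComplexDet n L` equals a REAL multiple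
of `Π_k (q_k - i p_k)`; hence `η(L)² · conj(Π_k (q_k - i p_k))²` is a non-negative real — all
transversal cells of one complete intersection have the same phase, i.e. the complete intersection is a
CALIBRATED cycle (HOME `run/shared/lean/pub/pub-hodge-tropical/certificates/splitpoint/`, K1-SCOPE §8).
Pure linear algebra over `Matrix.det`; no cycle is constructed here.

References: Zharkov, *Tropical abelian varieties, Weil classes and the Hodge conjecture* (2020), §2;
Mikhalkin–Zharkov, *Tropical eigenwave and intermediate Jacobians* (2014), Def. 4.2.
-/

noncomputable section

-- `Summit.HodgeConjecture.HodgeConjecture.…` is the mandated namespace (single-conjunct summit).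
set_option linter.dupNamespace false

open scoped BigOperators Matrix
open Matrix Literature.AlgebraicGeometry.Tropical

namespace Summit.HodgeConjecture.HodgeConjecture.Theorems.TropicalWeilVanishing.SplitPoint

variable {n : ℕ}

/-- **Phase law at the split point.** If the columns `(u | v)` of an integer `2n × n` frame `L` satisfy
`M u = diag(q) t`, `M v = -diag(p) t` column by column (`t` = the corresponding column of a real matrix
`T`) for an invertible real `M` — as the lattice frame of a transversal cell of the complete intersection
`h_1^*Θ_A ⋯ h_n^*Θ_A`, `h_k = (p_k, q_k)`, does — then
`η(L) = (det T / det M) · Π_k (q_k - i·p_k)`. [folklore] -/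
theorem frameComplexDet_eq_real_mul_prod (L : Matrix (Fin (2 * n)) (Fin n) ℤ)
    (M T : Matrix (Fin n) (Fin n) ℝ) (hM : M.det ≠ 0) (p q : Fin n → ℝ)
    (hx : ∀ k j, ∑ a : Fin n, M k a * ((L ⟨(a : ℕ), by omega⟩ j : ℤ) : ℝ) = q k * T k j)
    (hy : ∀ k j, ∑ a : Fin n, M k a * ((L ⟨(a : ℕ) + n, by omega⟩ j : ℤ) : ℝ) = -(p k * T k j)) :
    frameComplexDet n L =
      (((T.det / M.det : ℝ)) : ℂ) * ∏ k, ((q k : ℂ) - (p k : ℂ) * Complex.I) := by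
  -- the complex matrix of the frame
  set C : Matrix (Fin n) (Fin n) ℂ := Matrix.of fun k j : Fin n =>
    ((L ⟨(k : ℕ), by omega⟩ j : ℤ) : ℂ) + ((L ⟨(k : ℕ) + n, by omega⟩ j : ℤ) : ℂ) * Complex.I with hC
  have hdef : frameComplexDet n L = C.det := rfl
  -- key identity: M • C = diag(q - i p) • T
  have key : M.map ((↑) : ℝ → ℂ) * C =
      Matrix.diagonal (fun k => (q k : ℂ) - (p k : ℂ) * Complex.I) * T.map ((↑) : ℝ → ℂ) := by
    ext k j
    rw [Matrix.diagonal_mul, Matrix.mul_apply]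
    simp only [Matrix.map_apply, hC, Matrix.of_apply]
    have h1 := congrArg ((↑) : ℝ → ℂ) (hx k j)
    have h2 := congrArg ((↑) : ℝ → ℂ) (hy k j)
    push_cast at h1 h2
    calc ∑ a : Fin n, (M k a : ℂ) * (((L ⟨(a : ℕ), by omega⟩ j : ℤ) : ℂ) +
            ((L ⟨(a : ℕ) + n, by omega⟩ j : ℤ) : ℂ) * Complex.I)
        = (∑ a : Fin n, (M k a : ℂ) * ((L ⟨(a : ℕ), by omega⟩ j : ℤ) : ℂ)) +
            (∑ a : Fin n, (M k a : ℂ) * ((L ⟨(a : ℕ) + n, by omega⟩ j : ℤ) : ℂ)) * Complex.I := by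
          rw [Finset.sum_mul, ← Finset.sum_add_distrib]
          exact Finset.sum_congr rfl fun a _ => by ring
      _ = (q k : ℂ) * (T k j : ℂ) + -((p k : ℂ) * (T k j : ℂ)) * Complex.I := by rw [h1, h2]
      _ = ((q k : ℂ) - (p k : ℂ) * Complex.I) * (T k j : ℂ) := by ring
  have hdet := congrArg Matrix.det key
  rw [Matrix.det_mul, Matrix.det_mul, Matrix.det_diagonal] at hdet
  have hMdet : (M.map ((↑) : ℝ → ℂ)).det = ((M.det : ℝ) : ℂ) := by
    rw [show M.map ((↑) : ℝ → ℂ) = (Complex.ofRealHom : ℝ →+* ℂ).mapMatrix M from rfl,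
      ← RingHom.map_det]
    rfl
  have hTdet : (T.map ((↑) : ℝ → ℂ)).det = ((T.det : ℝ) : ℂ) := by
    rw [show T.map ((↑) : ℝ → ℂ) = (Complex.ofRealHom : ℝ →+* ℂ).mapMatrix T from rfl,
      ← RingHom.map_det]
    rfl
  rw [hMdet, hTdet] at hdet
  have hM' : ((M.det : ℝ) : ℂ) ≠ 0 := by exact_mod_cast hM
  have hC' : C.det = ((M.det : ℝ) : ℂ)⁻¹ *
      ((∏ k, ((q k : ℂ) - (p k : ℂ) * Complex.I)) * ((T.det : ℝ) : ℂ)) := by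
    rw [← hdet, ← mul_assoc, inv_mul_cancel₀ hM', one_mul]
  rw [hdef, hC']
  push_cast [div_eq_mul_inv]
  ring

/-- **Complete intersections at the split point are calibrated.** Under the same hypotheses,
`η(L)² · conj((Π_k (q_k - i p_k))²)` is a non-negative real number: the square of the complex determinant
of every transversal cell of the complete intersection `h_1^*Θ_A ⋯ h_n^*Θ_A` lies on the one real ray
`ℝ_{≥0} · (Π_k (q_k - i p_k))²`, so the cycle is calibrated (`|W| = μ`) with that phase. [folklore] -/
theorem sq_frameComplexDet_mul_conj_nonneg (L : Matrix (Fin (2 * n)) (Fin n) ℤ)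
    (M T : Matrix (Fin n) (Fin n) ℝ) (hM : M.det ≠ 0) (p q : Fin n → ℝ)
    (hx : ∀ k j, ∑ a : Fin n, M k a * ((L ⟨(a : ℕ), by omega⟩ j : ℤ) : ℝ) = q k * T k j)
    (hy : ∀ k j, ∑ a : Fin n, M k a * ((L ⟨(a : ℕ) + n, by omega⟩ j : ℤ) : ℝ) = -(p k * T k j)) :
    (frameComplexDet n L ^ 2 *
        (starRingEnd ℂ) ((∏ k, ((q k : ℂ) - (p k : ℂ) * Complex.I)) ^ 2)).im = 0 ∧
      0 ≤ (frameComplexDet n L ^ 2 *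
        (starRingEnd ℂ) ((∏ k, ((q k : ℂ) - (p k : ℂ) * Complex.I)) ^ 2)).re := by
  rw [frameComplexDet_eq_real_mul_prod L M T hM p q hx hy]
  set d : ℂ := ∏ k, ((q k : ℂ) - (p k : ℂ) * Complex.I) with hd
  set r : ℝ := T.det / M.det with hr
  have h : ((r : ℂ) * d) ^ 2 * (starRingEnd ℂ) (d ^ 2) = (((r ^ 2 * ‖d‖ ^ 4 : ℝ)) : ℂ) := by
    have hn : d * (starRingEnd ℂ) d = ((‖d‖ ^ 2 : ℝ) : ℂ) := by
      rw [Complex.mul_conj, Complex.normSq_eq_norm_sq]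
    calc ((r : ℂ) * d) ^ 2 * (starRingEnd ℂ) (d ^ 2)
        = (r : ℂ) ^ 2 * (d * (starRingEnd ℂ) d) ^ 2 := by rw [map_pow]; ring
      _ = (((r ^ 2 * ‖d‖ ^ 4 : ℝ)) : ℂ) := by rw [hn]; push_cast; ring
  rw [h]
  refine ⟨Complex.ofReal_im _, ?_⟩
  rw [Complex.ofReal_re]
  positivity

end Summit.HodgeConjecture.HodgeConjecture.Theorems.TropicalWeilVanishing.SplitPoint

end
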